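import Summits.NavierStokesRegularity.NavierStokesRegularity.Theorems.ScaledTopAlignmentFlexibleZoom
import HarnessLib

/-!
# Route `ScaledTopAlignment`: the flexible Type-I zoom WITH LOCALLY UNIFORM slice convergence of the
# vorticity zooms (support for the deciding crux W3ᵐᵗ = `AprioriMostTimesBulkAlignment`,
# stmt-NavierStokesRegularity-19551; no import of the route file)

The tree's `typeIZoom_ancientMild_limit_flexible` (`ScaledTopAlignmentFlexibleZoom`: KNSS 2009 §6
rescaling about Leray near-maximum points at caller-chosen base times, `C¹_loc` compactness
`exists_tendsto_of_typeI_seq_Ioo`, diagonal slices) exports the convergence of the vorticity zooms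
`(λ_j²/ν) ω(T + λ_j² s/ν, x_j + λ_j y) → curl W(s)(y)` POINTWISE in `y`. The compactness theorem it
rests on proves more — the spatial gradients of the zooms converge LOCALLY UNIFORMLY on every slice
(KNSS 2009, Prop. 4.1 / (4.10)–(4.11): window-uniform `C²` bounds, Arzelà–Ascoli) — and consumers that
must control the zoomed vorticity on a whole ball at once (e.g. to keep a segment inside a top region
`{|ω| > d}` before applying a mean-value inequality, as in the tree's discharge of Giga–Miura 2011,
Cor. 2.6, `ScaledTopAlignmentGigaMiuraDirectionGradient`) need exactly that. This module re-runs the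
construction and exports, in addition to everything `typeIZoom_ancientMild_limit_flexible` gives, the
locally uniform convergence of the vorticity zooms on every slice `s < 0`
(`typeIZoom_ancientMild_limit_flexible_locUnif`).
WHAT THIS IS NOT: not NS regularity; a compactness statement about Type-I blow-ups (which the
residual hard core NoTypeII says are the only ones).

## References
* G. Koch, N. Nadirashvili, G. Seregin, V. Šverák, Acta Math. 203 (2009) 83–105 = arXiv:0709.3599:
  §4 Prop. 4.1 with (4.10)–(4.11) (p. 8), §6 Lemma 6.1 and proof of Thm 6.2 (pp. 11–13).
  [KochNadirashviliSereginSverak2009]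
* J. Leray, Acta Math. 63 (1934) 193–248, §19 (3.9). [Leray1934]
* Y. Giga, H. Miura, Comm. Math. Phys. 303 (2011) 289–300, §2.1 (the blow-up sequence). [GigaMiura2011]
-/

noncomputable section

-- the summit and its single sub-problem share the name (CONVENTIONS §1), as in every Theorems file
set_option linter.dupNamespace false

open MeasureTheory Set Function Filter TopologicalSpace Metric
open scoped Topology NNReal ENNReal InnerProductSpace RealInnerProductSpace

namespace Summit.NavierStokesRegularity.NavierStokesRegularity.Theorems

open Literature.Analysis Literature.Analysis.FluidPDE

section Zoom

variable {ν T : ℝ} {u : ℝ → EuclideanSpace ℝ (Fin 3) → EuclideanSpace ℝ (Fin 3)}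
  {p : ℝ → EuclideanSpace ℝ (Fin 3) → ℝ}

/-- **The flexible Type-I zoom limit, with locally uniform slice convergence.** For `ν > 0`, `T > 0`,
a classical solution `(u, p)` on `ℝ³ × [0, T)`, Leray–Hopf from `u 0`, bounded on every `[0, T'] × ℝ³`
(`T' < T`), with the Type-I rate at `T` and no smooth extension past `T`, and for ANY base times
`τ_j ∈ [0, T)`, `τ_j → T`: along a subsequence `φ` there are `C`, a Type-I ancient mild field `W`
(`IsTypeIAncientMild C W`) with `W(−1, 0) ≠ 0`, centres `x_j` and scales `λ_j > 0`,
`λ_j² = ν(T − τ_{φ j})`, `λ_j → 0`, such that (i) the slice `−1` is read at the caller's times —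
`(λ_j²/ν) ω(τ_{φ j}, x_j + λ_j y) → curl W(−1)(y)` for all `y`; (ii) for every `s < 0` and EVERY
sequence of slices `σ_j → s`, `(λ_j²/ν) ω(T + λ_j² σ_j/ν, x_j + λ_j y) → curl W(s)(y)` for all `y`;
and (iii) for every `s < 0` the vorticity zooms `y ↦ (λ_j²/ν) ω(T + λ_j² s/ν, x_j + λ_j y)` converge to
`curl W(s)` LOCALLY UNIFORMLY on `ℝ³` (KNSS 2009 §6 rescaling about Leray near-maximum points of
`u(τ_j)`, compactness `exists_tendsto_of_typeI_seq_Ioo` — whose locally uniform convergence of the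
gradients is composed with the linear map `curlCLM` — diagonal slices by `tendsto_fderiv_slice_diag`;
non-triviality from Leray's rate `‖u(t)‖_∞ ≥ c₀√ν/√(T − t)`).
[cite: KochNadirashviliSereginSverak2009, §6 Lemma 6.1 and proof of Thm 6.2 with Prop. 4.1 (arXiv:0709.3599 pp. 8, 11–13)] -/
theorem typeIZoom_ancientMild_limit_flexible_locUnif (hν : 0 < ν) (hT : 0 < T)
    (hsol : IsClassicalNSSolutionOn (Ico 0 T) ν 0 u p) (hLH : IsLerayHopfOn T ν 0 (u 0) u)
    (hslab : ∀ T' < T, ∃ M : ℝ, ∀ t ∈ Icc 0 T', ∀ x, ‖u t x‖ ≤ M)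
    (hI : IsTypeIBlowup u T) (hext : ¬ HasSmoothExtensionPast ν 0 u T)
    {τ : ℕ → ℝ} (hτ : ∀ j, τ j ∈ Ico 0 T) (hτT : Tendsto τ atTop (𝓝 T)) :
    ∃ φ : ℕ → ℕ, StrictMono φ ∧
      ∃ (C : ℝ) (W : ℝ → EuclideanSpace ℝ (Fin 3) → EuclideanSpace ℝ (Fin 3))
        (xc : ℕ → EuclideanSpace ℝ (Fin 3)) (lam : ℕ → ℝ),
        IsTypeIAncientMild C W ∧ W (-1) 0 ≠ 0 ∧ (∀ j, 0 < lam j) ∧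
        (∀ j, lam j ^ 2 = ν * (T - τ (φ j))) ∧ Tendsto lam atTop (𝓝 0) ∧
        (∀ y, Tendsto (fun j => (lam j ^ 2 / ν) • curl (u (τ (φ j))) (xc j + lam j • y)) atTop
          (𝓝 (curl (W (-1)) y))) ∧
        (∀ s < (0 : ℝ), ∀ σ : ℕ → ℝ, Tendsto σ atTop (𝓝 s) → ∀ y,
          Tendsto (fun j => (lam j ^ 2 / ν) • curl (u (T + lam j ^ 2 * σ j / ν)) (xc j + lam j • y))
            atTop (𝓝 (curl (W s) y))) ∧
        ∀ s < (0 : ℝ), TendstoLocallyUniformly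
          (fun j y => (lam j ^ 2 / ν) • curl (u (T + lam j ^ 2 * s / ν)) (xc j + lam j • y))
          (curl (W s)) atTop := by
  -- adapted from the tree's `typeIZoom_ancientMild_limit_flexible` (same construction; the locally
  -- uniform convergence of the gradients of `exists_tendsto_of_typeI_seq_Ioo` is kept and exported)
  have hbdd : ∀ T₁ ∈ Ioo 0 T, ∃ M : ℝ, ∀ t ∈ Icc 0 T₁, ∀ x, ‖u t x‖ ≤ M :=
    fun T₁ hT₁ => hslab T₁ hT₁.2
  -- Steps 1–2: Leray points and the global rate
  obtain ⟨c₀, hc₀, hlow⟩ := exists_lerayRate_points hν hT hsol hLH hbdd hext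
  obtain ⟨C₁, hrate⟩ := exists_global_typeI_rate (u := u) hT hbdd hI
  -- Step 3: scales `c_j² T = T - τ_j`
  set R : ℝ := Real.sqrt (ν * T) with hRdef
  have hR : 0 < R := Real.sqrt_pos.2 (mul_pos hν hT)
  have hR2 : R ^ 2 = ν * T := by rw [hRdef, Real.sq_sqrt (mul_pos hν hT).le]
  set α : ℝ := R / ν with hα
  set β : ℝ := R ^ 2 / ν with hβ
  have hν0 : ν ≠ 0 := hν.ne'
  have hβT : β = T := by
    rw [hβ, hR2]; field_simp
  have hβpos : 0 < β := by rw [hβT]; exact hT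
  have hTτ : ∀ k, 0 < T - τ k := fun k => sub_pos.2 (hτ k).2
  set c : ℕ → ℝ := fun k => Real.sqrt ((T - τ k) / T) with hcdef
  have hc : ∀ k, 0 < c k := fun k => by rw [hcdef]; exact Real.sqrt_pos.2 (div_pos (hTτ k) hT)
  have hc2 : ∀ k, c k ^ 2 * β = T - τ k := fun k => by
    rw [hcdef, Real.sq_sqrt (div_pos (hTτ k) hT).le, hβT]
    field_simp
  have hTτ0 : Tendsto (fun k => T - τ k) atTop (𝓝[>] 0) := by
    refine tendsto_nhdsWithin_iff.2 ⟨?_, Eventually.of_forall fun k => hTτ k⟩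
    have h := hτT.const_sub T
    rwa [sub_self] at h
  have hc0 : Tendsto c atTop (𝓝 0) := by
    have h1 : Tendsto (fun k => (T - τ k) / T) atTop (𝓝 0) := by
      have h := (tendsto_nhdsWithin_iff.1 hTτ0).1.div_const T
      rwa [zero_div] at h
    have h2 := (Real.continuous_sqrt.tendsto 0).comp h1
    rwa [Real.sqrt_zero] at h2
  -- the windows `(A k, 0)`, `A k = -(T/(c_k² β)) = -T/(T - τ_k) → -∞`
  set A : ℕ → ℝ := fun k => -(T / (c k ^ 2 * β)) with hAdef
  have hA : Tendsto A atTop atBot := by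
    have h1 : Tendsto (fun k => T / (T - τ k)) atTop atTop := by
      have h := (tendsto_inv_nhdsGT_zero.comp hTτ0).const_mul_atTop hT
      refine h.congr fun k => ?_
      simp only [comp_apply, div_eq_mul_inv]
    refine (tendsto_neg_atTop_atBot.comp h1).congr fun k => ?_
    simp only [hAdef, comp_apply, hc2 k]
  -- the near-maximum centres at the caller's times `τ_k = T + c_k² β (-1)`
  have htk : ∀ k, T + c k ^ 2 * β * (-1) = τ k := fun k => by rw [hc2 k]; ring
  choose xk hxk using fun k => hlow (τ k) (hτ k)
  -- the zooms
  set w : ℕ → ℝ → EuclideanSpace ℝ (Fin 3) → EuclideanSpace ℝ (Fin 3) :=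
    fun k => (c k * α) • stPull (c k ^ 2 * β) (c k * R) T (xk k) u with hwdef
  have hcw : ∀ k, ContinuousOn (uncurry (w k)) (Ioo (A k) 0 ×ˢ univ) := fun k =>
    zoom_continuousOn (x₀ := xk k) hν hsol hR hα hβ (hc k) le_rfl
  have hdivw : ∀ k, ∀ t ∈ Ioo (A k) 0, IsWeaklyDivFree (w k t) := fun k t ht =>
    zoom_isWeaklyDivFree (x₀ := xk k) hν hsol hR hα hβ (hc k) le_rfl ht
  have hmild : ∀ k, ∀ s t : ℝ, A k < s → s < t → t < 0 → ∀ x,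
      w k t x = UnboundedOperators.heatExtension (w k s) (t - s) x -
        oseenDuhamel 1 s (w k) (w k) t x := fun k s t hs hst ht x =>
    zoom_oseen_of_slab (x₀ := xk k) hν hT hsol hLH hbdd hR hα hβ (hc k) le_rfl hs hst ht x
  have hIw : ∀ k, ∀ t ∈ Ioo (A k) 0, ∀ x, ‖w k t x‖ ≤ (α * C₁ / Real.sqrt β) / Real.sqrt (-t) :=
    fun k t ht x => zoom_norm_le (T := T) (x₀ := xk k) (u := u) hR hα hβ hν (hc k) le_rfl hrate ht x
  -- Step 4: extraction
  obtain ⟨φ, hφ, W, hW, hpt, hptD, -, hLUD⟩ :=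
    exists_tendsto_of_typeI_seq_Ioo (α * C₁ / Real.sqrt β) hA hcw hdivw hmild hIw
  have hφt : Tendsto φ atTop atTop := hφ.tendsto_atTop
  -- Step 5: non-triviality at `(-1, 0)`
  have hsqrt : ∀ k, Real.sqrt (T - τ k) = c k * Real.sqrt T := fun k => by
    have e : T - τ k = (c k) ^ 2 * T := by rw [← hc2 k, hβT]
    rw [e, Real.sqrt_mul (sq_nonneg _), Real.sqrt_sq (hc k).le]
  have hkey : ∀ k, c k * α * (c₀ * Real.sqrt ν / Real.sqrt (T - τ k) / 2) = c₀ / 2 := fun k => by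
    rw [hsqrt k, hα, hRdef, Real.sqrt_mul hν.le]
    have hsν : Real.sqrt ν ≠ 0 := (Real.sqrt_pos.2 hν).ne'
    have hsT : Real.sqrt T ≠ 0 := (Real.sqrt_pos.2 hT).ne'
    have hck : c k ≠ 0 := (hc k).ne'
    have e1 : Real.sqrt ν * Real.sqrt T / ν = Real.sqrt T / Real.sqrt ν := by
      rw [div_eq_div_iff hν0 hsν]
      calc Real.sqrt ν * Real.sqrt T * Real.sqrt ν
          = Real.sqrt T * (Real.sqrt ν * Real.sqrt ν) := by ring
        _ = Real.sqrt T * ν := by rw [Real.mul_self_sqrt hν.le]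
    rw [e1]
    field_simp
  have hwk : ∀ k, c₀ / 2 ≤ ‖w k (-1) 0‖ := fun k => by
    have e : w k (-1) 0 = (c k * α) • u (τ k) (xk k) := by
      simp only [hwdef, smul_stPull_apply, smul_zero, add_zero, htk]
    rw [e, norm_smul, Real.norm_of_nonneg (by positivity : (0 : ℝ) ≤ c k * α), ← hkey k]
    exact mul_le_mul_of_nonneg_left (hxk k) (by positivity)
  have hW0 : W (-1) 0 ≠ 0 := by
    have hlim : c₀ / 2 ≤ ‖W (-1) 0‖ :=
      ge_of_tendsto' ((hpt (-1) (by norm_num) 0).norm) fun j => hwk (φ j)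
    intro h
    rw [h, norm_zero] at hlim
    linarith
  -- the scales along the subsequence
  set lam : ℕ → ℝ := fun j => c (φ j) * R with hlamdef
  have hlam : ∀ j, 0 < lam j := fun j => mul_pos (hc (φ j)) hR
  have hlam2 : ∀ j, lam j ^ 2 = ν * (T - τ (φ j)) := fun j => by
    rw [hlamdef, mul_pow, ← hc2 (φ j), hβ]
    field_simp
  have hlam0 : Tendsto lam atTop (𝓝 0) := by
    have h := (hc0.comp hφt).mul_const R
    rw [zero_mul] at h
    exact h
  -- the vorticity zooms are the vorticities of the zooms
  have key : ∀ j (s' : ℝ) (y : EuclideanSpace ℝ (Fin 3)),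
      (lam j ^ 2 / ν) • curl (u (T + lam j ^ 2 * s' / ν)) (xk (φ j) + lam j • y) =
        curl (w (φ j) s') y := fun j s' y => by
    rw [hwdef, curl_smul_stPull]
    have e1 : c (φ j) * α * (c (φ j) * R) = lam j ^ 2 / ν := by
      rw [hlamdef, hα]; field_simp
    have e2 : T + c (φ j) ^ 2 * β * s' = T + lam j ^ 2 * s' / ν := by
      rw [hlamdef, hβ]; field_simp
    rw [e1, e2]
  -- diagonal convergence along the subsequence
  have hdiag : ∀ s < (0 : ℝ), ∀ σ : ℕ → ℝ, Tendsto σ atTop (𝓝 s) → ∀ y,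
      Tendsto (fun j => curl (w (φ j) (σ j)) y) atTop (𝓝 (curl (W s) y)) := by
    intro s hs σ hσ y
    have hD : Tendsto (fun j => fderiv ℝ (w (φ j) (σ j)) y) atTop (𝓝 (fderiv ℝ (W s) y)) :=
      tendsto_fderiv_slice_diag (α * C₁ / Real.sqrt β) (hA.comp hφt) (fun j => hcw (φ j))
        (fun j => hdivw (φ j)) (fun j => hmild (φ j)) (fun j => hIw (φ j)) hs (hptD s hs y) hσ
    show Tendsto (fun j => curlCLM (fderiv ℝ (w (φ j) (σ j)) y)) atTop
      (𝓝 (curlCLM (fderiv ℝ (W s) y)))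
    exact (curlCLM.continuous.tendsto _).comp hD
  refine ⟨φ, hφ, α * C₁ / Real.sqrt β, W, fun j => xk (φ j), lam, hW, hW0, hlam, hlam2, hlam0,
    fun y => ?_, fun s hs σ hσ y => ?_, fun s hs => ?_⟩
  · -- the slice `-1` at the caller's times
    have e : ∀ j, τ (φ j) = T + lam j ^ 2 * (-1) / ν := fun j => by
      rw [hlam2 j]; field_simp; ring
    simp_rw [e, key]
    exact hdiag (-1) (by norm_num) (fun _ => -1) tendsto_const_nhds y
  · simp_rw [key]
    exact hdiag s hs σ hσ y
  · -- locally uniform convergence on the slice `s`: the zooms are `curlCLM ∘ D(w (φ j) s)`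
    have e : (fun j y => (lam j ^ 2 / ν) • curl (u (T + lam j ^ 2 * s / ν)) (xk (φ j) + lam j • y)) =
        fun j => (⇑curlCLM) ∘ fderiv ℝ (w (φ j) s) := by
      funext j y
      rw [key]
      rfl
    rw [e, curl_eq_curlCLM_comp]
    exact curlCLM.uniformContinuous.comp_tendstoLocallyUniformly (hLUD s hs)

end Zoom

end Summit.NavierStokesRegularity.NavierStokesRegularity.Theorems

end
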